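import Mathlib
import HarnessLib
import HarnessLib.Audit
import Summits.HubbardSuperconductivity.HubbardSuperconductivity.Theses.SeamInduction

/-!
# SeamGluingLocality — negative note: the crux as typed forbids a width-uniform pair charge gap
# at EVERY `(U, δ) ∈ (0,∞) × (0, 3/10)` (gap extensivity breaks inequality (3))

Crux-strategist note for `stmt-HubbardSuperconductivity-18509`
(`Theses.SeamInduction.SeamGluingLocality`, route `route-HubbardSuperconductivity-SeamInduction`).

`seam_consequences`: specialising the crux to EQUAL parts `M′ = M″ = m`, `M = 2m` (same carrier
for both parts) gives, for every `U > 0`, `δ ∈ (0, 3/10)`, eventually in `(L, m)`: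
(i) `0 ≤ stiff_{L,2m}` and (ii) `0 ≤ icomp_{L,2m}` (the refuters' hidden sign claims, re-derived),
and (iii) the DOUBLING CEILING `icomp_{L,2m} ≤ (1 + M₂/2m) · (icomp_{L,m})₊`.

`not_seamGluingLocality_of_uniformPairGap`: the normalisation `icomp = L·M·Δ²_N E/4` is INTENSIVE
only for compressible tubes; for a charge-gapped tube `Δ²_N E → 2Δ_pair > 0` and `icomp ≈ L·M·Δ/2`
is EXTENSIVE, so doubling the width doubles `icomp` and (iii) fails by a factor `→ 2`. Precisely:
if at some `(U, δ)` in the window all sufficiently wide even tubes have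
`g·L·m ≤ icomp_{L,m} ≤ G·L·m` for all long even `L` (a width-uniform two-particle charge gap,
`Δ²_N E ∈ [4g, 4G]`) with `G < 4g/3`, then `SeamGluingLocality` is FALSE. Hence any proof of the
crux must in particular exclude a width-uniform pair charge gap at every point of
`(0,∞) × (0,3/10)` — including the filled-stripe point `(U, δ) = (8, 1/8)` of
`Literature.Barriers.HubbardSuperconductivity.PureModelStripeCompetition` [QinEtAl2020] — although
`closes` uses the crux only at the witness `(U, δ)` of `PerWidthThermodynamics`. This supports the
refuters' repair C‴ (conditional on the per-width data, which include `icomp ≤ k`, i.e. NO gap,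
and guarded), cf. evidence `SeamRepairCG.lean` on the item. Nothing here refutes the crux: a
uniform gap is proved nowhere.
-/

namespace Summit.HubbardSuperconductivity.HubbardSuperconductivity.Cruxes.SeamGluingLocality.Negation

open scoped BigOperators Topology Manifold Classical MeasureTheory ProbabilityTheory Matrix InnerProductSpace ComplexConjugate ContinuousMap
open Filter Set Function TopologicalSpace MeasureTheory
open Literature.Hubbard
open Summit.HubbardSuperconductivity.HubbardSuperconductivity.Theses.SeamInduction

/-- HYPOTHESIS (used only as `(h : UniformPairGap)`; neither asserted nor filed as a conjecture —
its role is to exhibit what any proof of the crux must exclude). **Width-uniform pair charge gap at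
some point of the window** (the obstruction): there are
`U > 0`, `δ ∈ (0, 3/10)`, constants `0 < g`, `G < 4g/3` and a width `m₀` such that every even
width `m ≥ m₀` has, for all long even lengths `L ≥ max(m, L₁(m))` and every labelling,
`g·L·m ≤ icomp_{L,m}(U,δ) ≤ G·L·m` — i.e. the two-particle charge gap
`E(N+2) + E(N−2) − 2E(N)` of the tube lies in `[4g, 4G]`, nearly width-independent. (Same
let-prefix as the crux, verbatim.) [difficulty: open-problem; heuristically the filled-stripe
insulator at `(8, 1/8)`, QinEtAl2020] -/
def UniformPairGap : Prop :=
open Matrix Literature.MathematicalPhysics.QuantumLattice in let H0 : ∀ (L M : ℕ) (Λ : Type) [LinearOrder Λ] [Fintype Λ], (Λ ≃ ZMod L × ZMod M) → ℝ → Matrix (Finset (Orb Λ)) (Finset (Orb Λ)) ℂ := fun _ _ Λ _ _ e U => hamiltonian (SimpleGraph.fromRel fun x y : Λ => y = e.symm ((e x).1 + 1, (e x).2) ∨ y = e.symm ((e x).1, (e x).2 + 1)) 1 U; let Tw : ∀ (L M : ℕ) [NeZero L] [NeZero M] (Λ : Type) [LinearOrder Λ] [Fintype Λ], (Λ ≃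 ZMod L × ZMod M) → ℝ → Matrix (Finset (Orb Λ)) (Finset (Orb Λ)) ℂ := fun _ M _ _ _ _ _ e θ => ∑ b : ZMod M, ∑ σ : Fin 2, ((1 - Complex.exp (Complex.I * θ)) • (creation (orb (e.symm (0, b)) σ) * annihilation (orb (e.symm (-1, b)) σ)) + (1 - Complex.exp (-(Complex.I * θ))) • (creation (orb (e.symm (-1, b)) σ) * annihilation (orb (e.symm (0, b)) σ))); let E : ∀ (L M : ℕ) [NeZero L] [NeZero M] (Λ : Type) [LinearOrder Λ] [Fintype Λ], (Λ ≃ ZMod L × ZMod M) → ℝ → ℝ → ℕ → ℝ := fun L M _ _ Λ _ _ e U θ N => (H0 L M Λ e U + Tw L M Λ e θ).minEnergyOn (szSector N 0); let Np : ℕ → ℕ → ℝ → ℕ := fun L M δ => 2 * ⌊(1 - δ) * ((L : ℝ) * (M : ℝ)) / 2⌋₊; let stiff : ∀ (L M : ℕ) [NeZero L] [NeZero M] (Λ : Type) [LinearOrder Λ] [Fintype Λ], (Λ ≃ ZMod L × ZMod M) → ℝ → ℝ → ℝ := fun L M _ _ Λ _ _ e U δ => 2 * (L : ℝ) * (E L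 M Λ e U (Real.pi / 3) (Np L M δ) - E L M Λ e U 0 (Np L M δ)) / ((Real.pi / 3) ^ 2 * (M : ℝ)); let icomp : ∀ (L M : ℕ) [NeZero L] [NeZero M] (Λ : Type) [LinearOrder Λ] [Fintype Λ], (Λ ≃ ZMod L × ZMod M) → ℝ → ℝ → ℝ := fun L M _ _ Λ _ _ e U δ => (L : ℝ) * (M : ℝ) * (E L M Λ e U 0 (Np L M δ + 2) + E L M Λ e U 0 (Np L M δ - 2) - 2 * E L M Λ e U 0 (Np L M δ)) / 4; ∃ U : ℝ, 0 < U ∧ ∃ δ ∈ Set.Ioo (0 : ℝ) (3 / 10), ∃ g G : ℝ, 0 < g ∧ G < 4 / 3 * g ∧ ∃ m₀ : ℕ, ∀ (m : ℕ) [NeZero m], Even m → m₀ ≤ m → ∃ L₁ : ℕ, ∀ (L : ℕ) [NeZero L], Even L → m ≤ L → L₁ ≤ L → ∀ (Λ : Type) [LinearOrder Λ] [Fintype Λ] (e : Λ ≃ ZMod L × ZMod m), g * L * m ≤ icomp L m Λ e U δ ∧ icomp L m Λ e U δ ≤ G * L * m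

/-- **Consequences of the crux at equal parts.** For every `U > 0`, `δ ∈ (0,3/10)` there are
`M₂, L₂` such that for all even `L ≥ L₂`, all even `m ≥ M₂` with `M = 2m ≤ L` and all labellings:
`0 ≤ stiff_{L,M}`, `0 ≤ icomp_{L,M}` (hidden unconditional sign claims) and the doubling ceiling
`icomp_{L,M} ≤ (1 + M₂/M)·max(icomp_{L,m}, 0)`. [folklore] -/
theorem seam_consequences (h : SeamGluingLocality) :
open Matrix Literature.MathematicalPhysics.QuantumLattice in let H0 : ∀ (L M : ℕ) (Λ : Type) [LinearOrder Λ] [Fintype Λ], (Λ ≃ ZMod L × ZMod M) → ℝ → Matrix (Finset (Orb Λ)) (Finset (Orb Λ)) ℂ := fun _ _ Λ _ _ e U => hamiltonian (SimpleGraph.fromRel fun x y : Λ => y = e.symm ((e x).1 + 1, (e x).2) ∨ y = e.symm ((e x).1, (e x).2 + 1)) 1 U; let Tw : ∀ (L M : ℕ) [NeZero L] [NeZero M] (Λ : Type) [LinearOrder Λ] [Fintype Λ], (Λ ≃ ZMod L × ZMod M) → ℝ → Matrix (Finset (Orb Λ)) (Finset (Orb Λ)) ℂ := fun _ M _ _ _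 _ _ e θ => ∑ b : ZMod M, ∑ σ : Fin 2, ((1 - Complex.exp (Complex.I * θ)) • (creation (orb (e.symm (0, b)) σ) * annihilation (orb (e.symm (-1, b)) σ)) + (1 - Complex.exp (-(Complex.I * θ))) • (creation (orb (e.symm (-1, b)) σ) * annihilation (orb (e.symm (0, b)) σ))); let E : ∀ (L M : ℕ) [NeZero L] [NeZero M] (Λ : Type) [LinearOrder Λ] [Fintype Λ], (Λ ≃ ZMod L × ZMod M) → ℝ → ℝ → ℕ → ℝ := fun L M _ _ Λ _ _ e U θ N => (H0 L M Λ e U + Tw L M Λ e θ).minEnergyOn (szSector N 0); let Np : ℕ → ℕ → ℝ → ℕ := fun L M δ => 2 * ⌊(1 - δ) * ((L : ℝ) * (M : ℝ)) / 2⌋₊; let stiff : ∀ (L M : ℕ) [NeZero L] [NeZero M] (Λ : Type) [LinearOrder Λ] [Fintype Λ], (Λ ≃ ZMod L × ZMod M) → ℝ → ℝ → ℝ := fun L M _ _ Λ _ _ e U δ => 2 * (L : ℝ) * (E L M Λ e U (Real.pi / 3) (Np L M δ) - E L M Λ e U 0 (Np L M δ)) / ((Real.pi / 3) ^ 2 *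 (M : ℝ)); let icomp : ∀ (L M : ℕ) [NeZero L] [NeZero M] (Λ : Type) [LinearOrder Λ] [Fintype Λ], (Λ ≃ ZMod L × ZMod M) → ℝ → ℝ → ℝ := fun L M _ _ Λ _ _ e U δ => (L : ℝ) * (M : ℝ) * (E L M Λ e U 0 (Np L M δ + 2) + E L M Λ e U 0 (Np L M δ - 2) - 2 * E L M Λ e U 0 (Np L M δ)) / 4; ∀ U : ℝ, 0 < U → ∀ δ ∈ Set.Ioo (0 : ℝ) (3 / 10), ∃ M₂ L₂ : ℕ, ∀ (L m M : ℕ) [NeZero L] [NeZero m] [NeZero M], Even L → Even m → M₂ ≤ m → m + m = M → M ≤ L → L₂ ≤ L → ∀ (Λ' : Type) [LinearOrder Λ'] [Fintype Λ'] (e' : Λ' ≃ ZMod L × ZMod m) (Λ : Type) [LinearOrder Λ] [Fintype Λ] (e : Λ ≃ ZMod L × ZMod M), 0 ≤ stiff L M Λ e U δ ∧ 0 ≤ icomp L M Λ e U δ ∧ icomp L M Λ e U δ ≤ (1 + (M₂ : ℝ) / M) * max (icomp L m Λ' e' U δ) 0 := by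
  dsimp only
  intro U hU δ hδ
  obtain ⟨M₂, L₂, hC⟩ := h U hU δ hδ
  refine ⟨M₂, L₂, ?_⟩
  intro L m M _ _ _ hL hm hM₂ hmm hML hL₂ Λ' _ _ e' Λ _ _ e
  obtain ⟨h1, h2, h3⟩ := hC L m m M hL hm hm hM₂ hM₂ hmm hML hL₂ Λ' e' Λ' e' Λ e
  have hM0 : (0 : ℝ) < M := by exact_mod_cast Nat.pos_of_ne_zero (NeZero.ne M)
  have hM₂M : (M₂ : ℝ) ≤ M := by exact_mod_cast (show M₂ ≤ M by omega)
  have hf : 0 ≤ 1 - (M₂ : ℝ) / M := by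
    rw [sub_nonneg, div_le_one hM0]; exact hM₂M
  refine ⟨le_trans (mul_nonneg hf (le_max_right _ _)) h1,
    le_trans (mul_nonneg hf (le_max_right _ _)) h2, ?_⟩
  simpa only [max_self] using h3


/-- **Gap extensivity breaks the crux.** A width-uniform pair charge gap at one point of the
window (`UniformPairGap`) contradicts `SeamGluingLocality`: with `M′ = M″ = m`, `M = 2m`,
inequality (3) reads `2g·L·m ≤ icomp_{L,2m} ≤ (1 + M₂/2m)·icomp_{L,m} ≤ (3/2)·G·L·m`, i.e.
`G ≥ 4g/3`. [folklore] -/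
theorem not_seamGluingLocality_of_uniformPairGap (hgap : UniformPairGap) : ¬ SeamGluingLocality := by
  intro h
  have hC0 := seam_consequences h
  clear h
  dsimp only [UniformPairGap] at hgap
  dsimp only at hC0
  obtain ⟨U, hU, δ, hδ, g, G, hg, hG, m₀, hgap⟩ := hgap
  obtain ⟨M₂, L₂, hC⟩ := hC0 U hU δ hδ
  clear hC0
  obtain ⟨m, hmE, hmM₂, hmm₀, hm0⟩ : ∃ m : ℕ, Even m ∧ M₂ ≤ m ∧ m₀ ≤ m ∧ 0 < m :=
    ⟨2 * (M₂ + m₀ + 1), even_two_mul _, by omega, by omega, by omega⟩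
  haveI im : NeZero m := ⟨by omega⟩
  obtain ⟨M, hMd⟩ : ∃ M : ℕ, M = m + m := ⟨_, rfl⟩
  haveI iM : NeZero M := ⟨by omega⟩
  have hME : Even M := ⟨m, hMd⟩
  obtain ⟨L₁, hm₁⟩ := @hgap m im hmE hmm₀
  obtain ⟨L₁', hM₁⟩ := @hgap M iM hME (by omega)
  clear hgap
  obtain ⟨L, hLE, hL1, hL2, hL3, hL4⟩ :
      ∃ L : ℕ, Even L ∧ L₁ ≤ L ∧ L₁' ≤ L ∧ L₂ ≤ L ∧ M ≤ L :=
    ⟨2 * (L₁ + L₁' + L₂ + M + 1), even_two_mul _, by omega, by omega, by omega, by omega⟩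
  haveI iL : NeZero L := ⟨by omega⟩
  have car : ∀ (a b : ℕ) [NeZero a] [NeZero b], ∃ e : Fin (a * b) ≃ ZMod a × ZMod b, True :=
    fun a b _ _ => ⟨finProdFinEquiv.symm.trans
      (Equiv.prodCongr (ZMod.finEquiv a).toEquiv (ZMod.finEquiv b).toEquiv), trivial⟩
  obtain ⟨e', -⟩ := car L m
  obtain ⟨e, -⟩ := car L M
  obtain ⟨hlo', hhi'⟩ := @hm₁ L iL hLE (by omega) hL1 (Fin (L * m)) _ _ e'
  obtain ⟨hlo, -⟩ := @hM₁ L iL hLE hL4 hL2 (Fin (L * M)) _ _ e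
  obtain ⟨-, -, h3⟩ := @hC L m M iL im iM hLE hmE hmM₂ hMd.symm hL4 hL3 (Fin (L * m)) _ _ e'
    (Fin (L * M)) _ _ e
  clear hm₁ hM₁ hC
  have hL0 : (0 : ℝ) < L := by exact_mod_cast Nat.pos_of_ne_zero (NeZero.ne L)
  have hm0R : (0 : ℝ) < m := by exact_mod_cast hm0
  have hMR : (M : ℝ) = m + m := by rw [hMd]; push_cast; ring
  have hM₂m : (M₂ : ℝ) ≤ m := by exact_mod_cast hmM₂
  have hpos' : 0 < g * L * m := by positivity
  rw [max_eq_left (hpos'.le.trans hlo')] at h3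
  have hfac : (1 + (M₂ : ℝ) / M) ≤ 3 / 2 := by
    rw [hMR]
    have : (M₂ : ℝ) / (m + m) ≤ 1 / 2 := by
      rw [div_le_iff₀ (by positivity)]; linarith
    linarith
  have hc'0 : 0 ≤ G * ↑L * ↑m := hpos'.le.trans (hlo'.trans hhi')
  have key : g * L * M ≤ 3 / 2 * (G * L * m) := by
    refine hlo.trans (h3.trans ?_)
    calc _ ≤ (1 + (M₂ : ℝ) / M) * (G * L * m) :=
          mul_le_mul_of_nonneg_left hhi' (by positivity)
      _ ≤ 3 / 2 * (G * L * m) := mul_le_mul_of_nonneg_right hfac hc'0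
  rw [hMR] at key
  have hLm : 0 < (L : ℝ) * m := by positivity
  nlinarith [key, hG, hLm, mul_pos hg hLm]

end Summit.HubbardSuperconductivity.HubbardSuperconductivity.Cruxes.SeamGluingLocality.Negation
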